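import Mathlib
import HarnessLib
import Literature.Barriers.CriticalPhenomena.RigorousRGSmallParameterGaussianIntegration
import Summits.HubbardSuperconductivity.HubbardSuperconductivity.Theorems.ComplexGFFStiffnessDefs
import Summits.HubbardSuperconductivity.HubbardSuperconductivity.Theorems.ComplexGFFStiffnessHypACumulantGreenSplit

/-!
# Crux `HypACumulant`, line `gnv` — the finite-range pieces as covariances: positivity on all
# fields and scale-by-scale factorisation `P_{C_1+⋯+C_{k+1}} = P_{C_1+⋯+C_k} ∗ P_{C_{k+1}}`

Route `route-HubbardSuperconductivity-ComplexGFFStiffness`, crux item stmt-HubbardSuperconductivity-19154,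
research stub `stub_gnvOfFrd : TorusFRD 4 → GNV`.  The kernels `𝒞_k` of the finite-range
decomposition (`GradientFRD.TorusFRD`, clauses (o) zero sum and evenness, (i) positivity on
ZERO-AVERAGE fields) are typed as functions on the torus; the tree's Gaussian calculus
(`LongRangePhi4.fieldGaussian`, `fieldGaussian_add`) wants positive semidefinite MATRICES.  This
file closes that gap: a zero-sum even kernel that is non-negative on mean-zero fields has a
positive semidefinite circulant matrix on ALL fields (the constants are in its kernel and its range
is mean-zero), so each `P_{C_k}`, `C_k = circulant 𝒞_k`, is a Gaussian measure and the free
measure `P_G`, `G = Σ_k C_k` (`sum_circulant_eq_greenMat_of_frd`), factorises scale by scale —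
the measures `μ_k` of Adams–Buchholz–Kotecký–Müller (arXiv:1910.13564, (6.9)–(6.10):
`μ^{(q)} = μ_1 ∗ ⋯ ∗ μ_{N+1}`).

## Contents (all proved; no definition, no named fact)
* `dotProduct_circulant_mulVec` — `(φ, circulant 𝒢 φ) = Σ_{x,y} φ(x) 𝒢(x−y) φ(y)` (the form of
  clause (i) of `TorusFRD`);
* **`posSemidef_circulant_of_frd`** — zero sum + even + non-negative on mean-zero fields ⇒
  `circulant 𝒢 ⪰ 0`;
* `posSemidef_sum_Icc` and **`fieldGaussian_sum_Icc_succ`** —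
  `P_{Σ_{j≤k+1} C_j} = P_{Σ_{j≤k} C_j} ∗ P_{C_{k+1}}` for positive semidefinite pieces (one
  renormalisation-group scale = one Gaussian convolution).

## References
* S. Adams, S. Buchholz, R. Kotecký, S. Müller, arXiv:1910.13564, Ch. 6.1, (6.9)–(6.10)
  [AdamsBuchholzKoteckyMuller2019]; S. Buchholz, arXiv:1603.06685, Thm 2.4 (i) [Buchholz2016].
-/

noncomputable section

-- `Summit.<Summit>.<Problem>`: single-conjunct summit, the duplicate component is mandated (D-0017).
set_option linter.dupNamespace false

namespace Summit.HubbardSuperconductivity.HubbardSuperconductivity.Theorems.ComplexGFF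

open scoped BigOperators Matrix MeasureTheory
open Literature.Barriers.CriticalPhenomena.LongRangePhi4 (fieldGaussian fieldGaussian_add)

variable {n : ℕ} [NeZero n]

/-- The quadratic form of a circulant matrix: `(φ, circulant 𝒢 φ) = Σ_x Σ_y φ(x) 𝒢(x − y) φ(y)`
(the expression of clause (i) of `GradientFRD.TorusFRD`). -/
theorem dotProduct_circulant_mulVec (𝒢 φ : (Fin 4 → ZMod n) → ℝ) :
    φ ⬝ᵥ (Matrix.circulant 𝒢 *ᵥ φ) = ∑ x, ∑ y, φ x * 𝒢 (x - y) * φ y := by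
  simp only [dotProduct, Matrix.mulVec, Matrix.circulant_apply, Finset.mul_sum, mul_assoc]

/-- **Positivity on all fields from positivity on mean-zero fields.**  A kernel `𝒢` on
`Λ = (ℤ/n)^4` with zero sum, even, and with `Σ_{x,y} φ(x)𝒢(x−y)φ(y) ≥ 0` for every zero-average
`φ` (clauses (o), (i) of `TorusFRD`) has a positive semidefinite circulant matrix: constants are in
its kernel (`circulant_mulVec_const`) and its range is mean-zero (`sum_circulant_mulVec`), so only
the mean-zero part of a field is seen. -/
theorem posSemidef_circulant_of_frd {𝒢 : (Fin 4 → ZMod n) → ℝ} (h0 : ∑ x, 𝒢 x = 0)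
    (heven : ∀ x, 𝒢 (-x) = 𝒢 x)
    (hpos : ∀ φ : (Fin 4 → ZMod n) → ℝ, ∑ x, φ x = 0 → 0 ≤ ∑ x, ∑ y, φ x * 𝒢 (x - y) * φ y) :
    (Matrix.circulant 𝒢).PosSemidef := by
  have hsymm : (Matrix.circulant 𝒢).IsHermitian := by
    unfold Matrix.IsHermitian
    rw [Matrix.conjTranspose_eq_transpose_of_trivial, Matrix.transpose_circulant]
    exact congrArg Matrix.circulant (funext heven)
  refine Matrix.PosSemidef.of_dotProduct_mulVec_nonneg hsymm fun v => ?_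
  rw [star_trivial]
  set N : ℝ := (Fintype.card (Fin 4 → ZMod n) : ℝ) with hN
  have hN0 : N ≠ 0 := by rw [hN]; exact_mod_cast Fintype.card_ne_zero
  -- split off the mean
  set c : ℝ := (∑ x, v x) / N with hc
  set w : (Fin 4 → ZMod n) → ℝ := v - fun _ => c with hw
  have hw0 : ∑ x, w x = 0 := by
    simp only [hw, Pi.sub_apply, Finset.sum_sub_distrib, Finset.sum_const, Finset.card_univ,
      nsmul_eq_mul]
    rw [hc]; field_simp; ring
  have hv : v = w + fun _ => c := by rw [hw, sub_add_cancel]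
  have hMv : Matrix.circulant 𝒢 *ᵥ v = Matrix.circulant 𝒢 *ᵥ w := by
    rw [hv, Matrix.mulVec_add, circulant_mulVec_const h0, add_zero]
  have hsum : (fun _ : Fin 4 → ZMod n => c) ⬝ᵥ (Matrix.circulant 𝒢 *ᵥ w) = 0 := by
    simp only [dotProduct, ← Finset.mul_sum, sum_circulant_mulVec h0 w, mul_zero]
  rw [hMv, hv, add_dotProduct, hsum, add_zero, dotProduct_circulant_mulVec]
  exact hpos w hw0

/-- A sum of positive semidefinite pieces over `k = 1, …, m` is positive semidefinite. -/
theorem posSemidef_sum_Icc {Λ : Type*} [Fintype Λ] [DecidableEq Λ] (C : ℕ → Matrix Λ Λ ℝ)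
    (m : ℕ) (hC : ∀ k ∈ Finset.Icc 1 m, (C k).PosSemidef) :
    (∑ k ∈ Finset.Icc 1 m, C k).PosSemidef :=
  Matrix.posSemidef_sum _ fun k hk => hC k hk

/-- **One scale = one Gaussian convolution.**  For positive semidefinite pieces `C_1, …, C_{k+1}`,
`P_{C_1 + ⋯ + C_{k+1}} = P_{C_1 + ⋯ + C_k} ∗ P_{C_{k+1}}` on field space — progressive integration
of the free measure `P_G`, `G = Σ_{k=1}^{N+1} C_k`, over the scales of the finite-range
decomposition (`μ^{(q)} = μ_1 ∗ ⋯ ∗ μ_{N+1}` of the reference). -/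
theorem fieldGaussian_sum_Icc_succ {Λ : Type*} [Fintype Λ] [DecidableEq Λ] {m' : ℕ}
    (C : ℕ → Matrix Λ Λ ℝ) (k : ℕ) (hC : ∀ j ∈ Finset.Icc 1 (k + 1), (C j).PosSemidef) :
    fieldGaussian Λ (∑ j ∈ Finset.Icc 1 (k + 1), C j) m' =
      fieldGaussian Λ (∑ j ∈ Finset.Icc 1 k, C j) m' ∗ fieldGaussian Λ (C (k + 1)) m' := by
  rw [Finset.sum_Icc_succ_top (Nat.succ_le_succ (Nat.zero_le k))]
  refine fieldGaussian_add (posSemidef_sum_Icc C k fun j hj => hC j ?_) (hC (k + 1) ?_)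
  · exact Finset.Icc_subset_Icc_right (Nat.le_succ k) hj
  · exact Finset.right_mem_Icc.2 (Nat.succ_le_succ (Nat.zero_le k))

end Summit.HubbardSuperconductivity.HubbardSuperconductivity.Theorems.ComplexGFF

end
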